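import Summits.HodgeConjecture.HodgeConjecture.Theorems.F0P3ClassificationEngine
import HarnessLib

/-!
# `F0P3InnerFormClassification` (T5-D): the HEAD `shape_of_T5` — a pinned classification kit with the laws yields `(C1♮) ∧ (C2) ∧ (C3₀)` of Thm. 14.6.4
# at its frame — and the frame-universal composition `shapeGuarded_of_T5` over a named `KitFamily`, feeding ★ B0 `letters_guarded_of_shape` BY NAME

Theorems rendering (F0P3-plan (g4) RULINGS (V9)(b)∕(V12), F0P3-p03 (g6)) of the T5 statement layer = dossier line
`Cruxes/H413/Lines/F0_T5InnerFormClassification.lean` (v3.1 c06f45df; PLAN.F0P3g4 §22–§25), split by topic into four ★-importable modules sharing the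
namespace `…Cruxes.H413.F0P3InnerFormClassification` (Theorems never import Lines): (A) `F0P3ClassificationKit` — frame, e.v.p. germs, the kit, pins;
(B) `F0P3ClassificationLaws` — the named laws and the intermediate statements (14.6.2) ∕ coefficient formula; (C) `F0P3ClassificationEngine` — the
integrator's own mathematics Z3∕Z2∕Z10a, PROVED; (D) `F0P3InnerFormClassification` — glue, the head `shape_of_T5`, the kit-family composition
`shapeGuarded_of_T5`.  Declarations and proofs are BYTE-IDENTICAL to the dossier text; only module docstrings, the namespace name, a few one-line
docstrings (Theorems lint) and the re-emitted `variable` blocks differ.  No `sorry`, no named fact, no instance, no notation.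

THIS MODULE: §3 glue (`memberCoeff`∕`expansion` bounds, `mult_le_one_of_formula`), §4 `shape_of_T5`, §5 `KitFamily`, `shapeGuarded_of_T5` (default heartbeats), consumer checks.
HONEST LABEL: HC_CM is proved only modulo the printed citations until rung 0 closes.
-/

attribute [local instance 100] LieRing.ofAssociativeRing

set_option autoImplicit false
set_option linter.dupNamespace false

noncomputable section

open NumberField IsDedekindDomain MeasureTheory
open scoped Matrix ComplexOrder BigOperators Classical

namespace Summit.HodgeConjecture.HodgeConjecture.Cruxes.H413.F0P3InnerFormClassification

open Literature.NumberTheory.Rogawski1990 Literature.NumberTheory.GaloisRepresentations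
open Literature.NumberTheory.Automorphic Literature.NumberTheory.Automorphic.UnitaryGroup
open Literature.NumberTheory.Automorphic.UnitaryGroup.CotangentForms
open Literature.RepresentationTheory.BorelWallach2000
open Literature.RepresentationTheory.KonnoKonno2007

/-! ## §3 KERNEL-CHECKED GLUE: the expansion coefficients take values in `{−1, 0, 1}`·½… — `|E| ≤ 1`, and `E ≠ 0` only on the packet -/

namespace ClassificationKit

variable {L : Type} [Field L] [NumberField L] [IsCMField L] {H : Matrix (Fin 3) (Fin 3) L} {ι : L →+* ℂ} {T : GL (Fin 3) ℂ}
  {hT : (T : Matrix (Fin 3) (Fin 3) ℂ)ᴴ * H.map ι * (T : Matrix (Fin 3) (Fin 3) ℂ) = Literature.Geometry.ComplexHyperbolic.BallModel.J}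
  {μ : Measure (Gp L H).automorphicQuotient} [(Gp L H).IsAutomorphicMeasure μ] (𝔠 : ClassificationKit L H ι T hT μ)

/-- `memberCoeff ∈ {0, 1, −1}` for `ε = ±1`. [cite: Rogawski1990, §14.6 p. 238] -/
theorem memberCoeff_mem {C : Type*} (Pk : LocalAPacket C) (ε : ℚ) (hε : ε = 1 ∨ ε = -1) (x : C) :
    memberCoeff Pk ε x = 0 ∨ memberCoeff Pk ε x = 1 ∨ memberCoeff Pk ε x = -1 := by
  unfold memberCoeff
  rcases hε with h | h <;> subst h <;> split_ifs <;> simp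

/-- A non-zero member coefficient sits on a packet member. [cite: Rogawski1990, §14.6 p. 238] -/
theorem memberCoeff_ne_zero {C : Type*} (Pk : LocalAPacket C) (ε : ℚ) (x : C) (h : memberCoeff Pk ε x ≠ 0) : x ∈ Pk.members := by
  unfold memberCoeff at h
  rw [LocalAPacket.mem_members_iff]
  by_contra hx
  push Not at hx
  rw [if_neg hx.1, if_neg hx.2] at h
  exact h rfl

/-- `|memberCoeff| ≤ 1` for `ε = ±1`. [cite: Rogawski1990, §14.6 p. 238] -/
theorem abs_memberCoeff_le {C : Type*} (Pk : LocalAPacket C) (ε : ℚ) (hε : ε = 1 ∨ ε = -1) (x : C) : |memberCoeff Pk ε x| ≤ 1 := by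
  rcases memberCoeff_mem Pk ε hε x with h | h | h <;> rw [h] <;> simp

/-- `|∏_v memberCoeff_v| ≤ 1` for `ε = ±1`. [cite: Rogawski1990, §14.6 p. 238] -/
theorem abs_prod_memberCoeff_le (ξ : OneDimAutRepH L) (S : Finset (Places L)) (ε : ℚ) (hε : ε = 1 ∨ ε = -1)
    (x : ∀ v : ↥S, IrrClass ((cmDatum L 3 H).Local v.1)) :
    |∏ v : ↥S, memberCoeff (𝔠.packFin ξ v.1) ε (x v)| ≤ 1 := by
  rw [Finset.abs_prod]
  calc ∏ v : ↥S, |memberCoeff (𝔠.packFin ξ v.1) ε (x v)| ≤ ∏ v : ↥S, (1 : ℚ) :=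
        Finset.prod_le_prod (fun _ _ => abs_nonneg _) fun v _ => abs_memberCoeff_le _ ε hε _
    _ = 1 := by simp

/-- `|E_ξ(x)| ≤ 1`. -/
theorem abs_expansion_le (ξ : OneDimAutRepH L) (S : Finset (Places L)) (hc : 𝔠.sgnG ξ = 1 ∨ 𝔠.sgnG ξ = -1) (x : 𝔠.LocS S) :
    |𝔠.expansion ξ S x| ≤ 1 := by
  unfold expansion
  have hA : |memberCoeff (𝔠.packInf ξ) (-1) x.1 * ∏ v : ↥S, memberCoeff (𝔠.packFin ξ v.1) (-1) (x.2.2 v)| ≤ 1 := by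
    rw [abs_mul]
    calc _ ≤ (1 : ℚ) * 1 := mul_le_mul (abs_memberCoeff_le _ _ (Or.inr rfl) _) (𝔠.abs_prod_memberCoeff_le ξ S _ (Or.inr rfl) _)
          (abs_nonneg _) zero_le_one
      _ = 1 := one_mul _
  have hB : |memberCoeff (𝔠.packInf ξ) 1 x.1 * ∏ v : ↥S, memberCoeff (𝔠.packFin ξ v.1) 1 (x.2.2 v)| ≤ 1 := by
    rw [abs_mul]
    calc _ ≤ (1 : ℚ) * 1 := mul_le_mul (abs_memberCoeff_le _ _ (Or.inl rfl) _) (𝔠.abs_prod_memberCoeff_le ξ S _ (Or.inl rfl) _)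
          (abs_nonneg _) zero_le_one
      _ = 1 := one_mul _
  have hc' : |𝔠.sgnG ξ| = 1 := by rcases hc with h | h <;> rw [h] <;> simp
  have hF : |(if 𝔠.F0 ξ = some x.2.1 then (1 : ℚ) else 0)| ≤ 1 := by split_ifs <;> simp
  have hN : |((-1 : ℚ)) ^ 𝔠.N ξ| = 1 := by rw [abs_pow, abs_neg, abs_one, one_pow]
  calc _ = |(if 𝔠.F0 ξ = some x.2.1 then (1 : ℚ) else 0)| * (1 / 2) * |((-1 : ℚ)) ^ 𝔠.N ξ| *
            |memberCoeff (𝔠.packInf ξ) (-1) x.1 * ∏ v : ↥S, memberCoeff (𝔠.packFin ξ v.1) (-1) (x.2.2 v) +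
              𝔠.sgnG ξ * (memberCoeff (𝔠.packInf ξ) 1 x.1 * ∏ v : ↥S, memberCoeff (𝔠.packFin ξ v.1) 1 (x.2.2 v))| := by
          rw [abs_mul, abs_mul, abs_mul]; norm_num
    _ ≤ 1 * (1 / 2) * 1 * (1 + 1) := by
          rw [hN]
          refine mul_le_mul (mul_le_mul (mul_le_mul_of_nonneg_right hF (by norm_num)) le_rfl (by positivity) (by positivity)) ?_
            (abs_nonneg _) (by positivity)
          calc _ ≤ |memberCoeff (𝔠.packInf ξ) (-1) x.1 * ∏ v : ↥S, memberCoeff (𝔠.packFin ξ v.1) (-1) (x.2.2 v)| +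
                    |𝔠.sgnG ξ * (memberCoeff (𝔠.packInf ξ) 1 x.1 * ∏ v : ↥S, memberCoeff (𝔠.packFin ξ v.1) 1 (x.2.2 v))| := abs_add_le _ _
            _ ≤ 1 + 1 := by
                  refine add_le_add hA ?_
                  rw [abs_mul, hc', one_mul]; exact hB
    _ = 1 := by norm_num

/-- `E_ξ(x) ≠ 0 ⇒` every coordinate of `x` lies in its packet. -/
theorem coords_mem_of_expansion_ne_zero (ξ : OneDimAutRepH L) (S : Finset (Places L)) (x : 𝔠.LocS S) (h : 𝔠.expansion ξ S x ≠ 0) :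
    x.1 ∈ (𝔠.packInf ξ).members ∧ 𝔠.F0 ξ = some x.2.1 ∧ ∀ v : ↥S, x.2.2 v ∈ (𝔠.packFin ξ v.1).members := by
  unfold expansion at h
  refine ⟨?_, ?_, fun v => ?_⟩
  · by_contra hx
    have h1 : memberCoeff (𝔠.packInf ξ) (-1) x.1 = 0 := by
      by_contra h1; exact hx (memberCoeff_ne_zero _ _ _ h1)
    have h2 : memberCoeff (𝔠.packInf ξ) 1 x.1 = 0 := by
      by_contra h2; exact hx (memberCoeff_ne_zero _ _ _ h2)
    rw [h1, h2] at h; simp at h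
  · by_contra hF; rw [if_neg hF] at h; simp at h
  · by_contra hx
    have h1 : memberCoeff (𝔠.packFin ξ v.1) (-1) (x.2.2 v) = 0 := by
      by_contra h1; exact hx (memberCoeff_ne_zero _ _ _ h1)
    have h2 : memberCoeff (𝔠.packFin ξ v.1) 1 (x.2.2 v) = 0 := by
      by_contra h2; exact hx (memberCoeff_ne_zero _ _ _ h2)
    have p1 : ∏ w : ↥S, memberCoeff (𝔠.packFin ξ w.1) (-1) (x.2.2 w) = 0 := Finset.prod_eq_zero (Finset.mem_univ v) h1
    have p2 : ∏ w : ↥S, memberCoeff (𝔠.packFin ξ w.1) 1 (x.2.2 w) = 0 := Finset.prod_eq_zero (Finset.mem_univ v) h2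
    rw [p1, p2] at h; simp at h

/-- From the coefficient formula: `m ≤ 1`, and `m ≠ 0 ⇒` coordinates in the packets. -/
theorem mult_le_one_of_formula (hL : 𝔠.LocalExpansion) (hC : 𝔠.CoefficientFormula) (ξ : OneDimAutRepH L) (S : Finset (Places L)) (hS : 𝔠.ram ξ ⊆ S)
    (c : 𝔠.Cls) (hc : EqOff L H S (𝔠.evp c) (𝔠.tXi ξ)) (hr : 𝔠.ramCls c ⊆ S) :
    𝔠.mult c ≤ 1 ∧ (𝔠.mult c ≠ 0 →
      𝔠.clInf c ∈ (𝔠.packInf ξ).members ∧ 𝔠.F0 ξ = some (𝔠.cl0 c) ∧ ∀ v : ↥S, 𝔠.clFin c v.1 ∈ (𝔠.packFin ξ v.1).members) := by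
  have hform := hC ξ S hS c hc hr
  have habs := 𝔠.abs_expansion_le ξ S (hL ξ S hS).1 (𝔠.coordS S c)
  rw [← hform] at habs
  refine ⟨?_, fun hm => ?_⟩
  · have : (𝔠.mult c : ℚ) ≤ 1 := (le_abs_self _).trans habs
    exact_mod_cast this
  · have hE : 𝔠.expansion ξ S (𝔠.coordS S c) ≠ 0 := by rw [← hform]; exact_mod_cast hm
    exact 𝔠.coords_mem_of_expansion_ne_zero ξ S _ hE

end ClassificationKit

/-! ## §4 THE HEAD — `∀ frame, pinned kit with laws ⇒ (C1♮) ∧ (C2) ∧ (C3₀)` at that frame, KERNEL-CHECKED; CONCLUSION KIT-FREE -/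

/-- **THE HEAD OF T5 at one frame**: for a PINNED classification kit satisfying the laws, the guarded multiplicity bound (C1♮) (the conclusion of (C1) under the
token binders of (C2)), print's membership (C2) and one-`ξ`-per-token form (C3₀) of Thm. 14.6.4 hold — feeding ★ p814530 `cohDiscrete_memXiFamily_of_C30`,
`shape_C3_of_C30_of_rigid` (+ U♭ ★ p816079-to-be `F0P3XiRigid.memXiFamily_rigid_cm`) and p04 (g6)'s B0 `letters_guarded_of_shape` BY NAME.
(The binder `_hZ2 : 𝔠.PerClassIdentity` is carried for the dossier's interface and not used in this proof: (14.6.2) enters only through `hZ10`.)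
[cite: Rogawski1990, §14.6 Thm. 14.6.4 pp. 236–239; §13.7 p. 206; §15.3 ¶1] -/
theorem shape_of_T5 {L : Type} [Field L] [NumberField L] [IsCMField L] (H : Matrix (Fin 3) (Fin 3) L) (ι : L →+* ℂ) (T : GL (Fin 3) ℂ)
    (hT : (T : Matrix (Fin 3) (Fin 3) ℂ)ᴴ * H.map ι * (T : Matrix (Fin 3) (Fin 3) ℂ) = Literature.Geometry.ComplexHyperbolic.BallModel.J)
    (μ : Measure (Gp L H).automorphicQuotient) [(Gp L H).IsAutomorphicMeasure μ] (μω : HeckeCharacter L) (hμu : μω.IsUnitary)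
    (𝔠 : ClassificationKit L H ι T hT μ) (hpin : 𝔠.IsPinned) (hl : 𝔠.Laws μω hμu)
    -- the stubs' conclusions, as hypotheses of the composition:
    (_hZ2 : 𝔠.PerClassIdentity) (hZ10 : 𝔠.CoefficientFormula) :
    (∀ (P : DiscreteAutomorphicRep (Gp L H) μ) (M : Type) [AddCommGroup M] [Module ℂ M]
        (σK : Representation ℂ (uFormGroup (Fin 2) (Fin 1)).maximalCompact M) (σ𝔤 : (uFormGroup (Fin 2) (Fin 1)).lie →ₗ⁅ℝ⁆ Module.End ℂ M)
        (hM : IsGKModule (uFormGroup (Fin 2) (Fin 1)) σK σ𝔤), IsIrreducibleGK σK σ𝔤 →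
        (∃ T₁ : P.archModuleCM ι T hT →ₗ[ℂ] M,
          (∀ (k : (uFormGroup (Fin 2) (Fin 1)).maximalCompact) (w : P.archModuleCM ι T hT), T₁ (P.archRepKCM ι T hT k w) = σK k (T₁ w)) ∧
            (∀ (X : (uFormGroup (Fin 2) (Fin 1)).lie) (w : P.archModuleCM ι T hT), T₁ (P.archRepLieCM ι T hT X w) = σ𝔤 X (T₁ w)) ∧ T₁ ≠ 0) →
        ∀ δ : ℤ, (δ = 1 ∨ δ = -1) → upqTypeClasses σK σ𝔤 hM.ad_compat 1 δ ≠ ⊥ →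
          ((Gp L H).rightRegular μ).multiplicity P.space.toContRep ≤ 1) ∧
    (∀ (P : DiscreteAutomorphicRep (Gp L H) μ) (M : Type) [AddCommGroup M] [Module ℂ M]
        (σK : Representation ℂ (uFormGroup (Fin 2) (Fin 1)).maximalCompact M) (σ𝔤 : (uFormGroup (Fin 2) (Fin 1)).lie →ₗ⁅ℝ⁆ Module.End ℂ M)
        (hM : IsGKModule (uFormGroup (Fin 2) (Fin 1)) σK σ𝔤), IsIrreducibleGK σK σ𝔤 →
        (∃ T₁ : P.archModuleCM ι T hT →ₗ[ℂ] M,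
          (∀ (k : (uFormGroup (Fin 2) (Fin 1)).maximalCompact) (w : P.archModuleCM ι T hT), T₁ (P.archRepKCM ι T hT k w) = σK k (T₁ w)) ∧
            (∀ (X : (uFormGroup (Fin 2) (Fin 1)).lie) (w : P.archModuleCM ι T hT), T₁ (P.archRepLieCM ι T hT X w) = σ𝔤 X (T₁ w)) ∧ T₁ ≠ 0) →
        ∀ δ : ℤ, (δ = 1 ∨ δ = -1) → upqTypeClasses σK σ𝔤 hM.ad_compat 1 δ ≠ ⊥ →
          ∃ ξ : OneDimAutRepH L,
            MemXiFamily P (transpose_map_cmConjRingHom_eq_of_frame L ι H T hT) (isUnit_det_of_frame L ι H T hT) μω hμu ξ) ∧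
    (∃ sgn : OneDimAutRepH L → ℤ,
      ∀ (P : DiscreteAutomorphicRep (Gp L H) μ) (M : Type) [AddCommGroup M] [Module ℂ M]
        (σK : Representation ℂ (uFormGroup (Fin 2) (Fin 1)).maximalCompact M) (σ𝔤 : (uFormGroup (Fin 2) (Fin 1)).lie →ₗ⁅ℝ⁆ Module.End ℂ M)
        (hM : IsGKModule (uFormGroup (Fin 2) (Fin 1)) σK σ𝔤), IsIrreducibleGK σK σ𝔤 →
        (∃ T₁ : P.archModuleCM ι T hT →ₗ[ℂ] M,
          (∀ (k : (uFormGroup (Fin 2) (Fin 1)).maximalCompact) (w : P.archModuleCM ι T hT), T₁ (P.archRepKCM ι T hT k w) = σK k (T₁ w)) ∧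
            (∀ (X : (uFormGroup (Fin 2) (Fin 1)).lie) (w : P.archModuleCM ι T hT), T₁ (P.archRepLieCM ι T hT X w) = σ𝔤 X (T₁ w)) ∧ T₁ ≠ 0) →
        ∀ δ : ℤ, (δ = 1 ∨ δ = -1) → upqTypeClasses σK σ𝔤 hM.ad_compat 1 δ ≠ ⊥ →
          ∃ ξ : OneDimAutRepH L,
            MemXiFamily P (transpose_map_cmConjRingHom_eq_of_frame L ι H T hT) (isUnit_det_of_frame L ι H T hT) μω hμu ξ ∧ δ = sgn ξ) := by
  -- the common core: a token routes `P` to `ξ` off some `S₁`; the coefficient reading at `S := S₁ ∪ ram ξ ∪ ramCls (cl P)` bounds and locates `P`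
  have core : ∀ (P : DiscreteAutomorphicRep (Gp L H) μ) (M : Type) [AddCommGroup M] [Module ℂ M]
      (σK : Representation ℂ (uFormGroup (Fin 2) (Fin 1)).maximalCompact M) (σ𝔤 : (uFormGroup (Fin 2) (Fin 1)).lie →ₗ⁅ℝ⁆ Module.End ℂ M)
      (hM : IsGKModule (uFormGroup (Fin 2) (Fin 1)) σK σ𝔤) (hirr : IsIrreducibleGK σK σ𝔤), HasToken L H ι T hT μ P M σK σ𝔤 →
      ∀ δ : ℤ, (δ = 1 ∨ δ = -1) → upqTypeClasses σK σ𝔤 hM.ad_compat 1 δ ≠ ⊥ →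
        ∃ ξ : OneDimAutRepH L, 𝔠.mult (𝔠.cl P) ≤ 1 ∧ 𝔠.clInf (𝔠.cl P) ∈ (𝔠.packInf ξ).members ∧
          (∀ v : Places L, 𝔠.clFin (𝔠.cl P) v ∈ (𝔠.packFin ξ v).members) := by
    intro P M _ _ σK σ𝔤 hM hirr htok δ hδ hne'
    obtain ⟨ξ, S₁, hξ⟩ := hl.routing P M σK σ𝔤 hM hirr htok δ hδ hne'
    set S : Finset (Places L) := S₁ ∪ 𝔠.ram ξ ∪ 𝔠.ramCls (𝔠.cl P) with hSdef
    have hS₁ : S₁ ⊆ S := Finset.subset_union_left.trans Finset.subset_union_left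
    have hS : 𝔠.ram ξ ⊆ S := Finset.subset_union_right.trans Finset.subset_union_left
    have hr : 𝔠.ramCls (𝔠.cl P) ⊆ S := Finset.subset_union_right
    have hξS : EqOff L H S (𝔠.evp (𝔠.cl P)) (𝔠.tXi ξ) := EqOff.mono L H hS₁ hξ
    obtain ⟨hle, hmem⟩ := 𝔠.mult_le_one_of_formula hl.localExpansion hZ10 ξ S hS (𝔠.cl P) hξS hr
    have hm1 : (1 : ℕ∞) ≤ ((𝔠.mult (𝔠.cl P) : ℕ) : ℕ∞) := by rw [hpin.1 P]; exact one_le_multiplicity L H μ P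
    have hm0 : 𝔠.mult (𝔠.cl P) ≠ 0 := by
      have : 1 ≤ 𝔠.mult (𝔠.cl P) := by exact_mod_cast hm1
      omega
    obtain ⟨hinf, -, hfin⟩ := hmem hm0
    refine ⟨ξ, hle, hinf, fun v => ?_⟩
    by_cases hv : v ∈ S
    · exact hfin ⟨v, hv⟩
    · have hv1 : v ∉ 𝔠.ram ξ := fun h => hv (hS h)
      have hv2 : v ∉ 𝔠.ramCls (𝔠.cl P) := fun h => hv (hr h)
      rw [𝔠.unramMember_of_pins hpin hl.xiUnram ξ (𝔠.cl P) v hv1 hv2 (hξS v hv)]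
      exact LocalAPacket.πn_mem_members _
  -- membership in the ξ-local family from coordinates in the packets
  have memb : ∀ (P : DiscreteAutomorphicRep (Gp L H) μ) (ξ : OneDimAutRepH L), (∀ v : Places L, 𝔠.clFin (𝔠.cl P) v ∈ (𝔠.packFin ξ v).members) →
      MemXiFamily P (transpose_map_cmConjRingHom_eq_of_frame L ι H T hT) (isUnit_det_of_frame L ι H T hT) μω hμu ξ := by
    intro P ξ hfin
    refine ⟨𝔠.packFin ξ, hl.xiFamilyFin ξ, fun v c' hc' => ?_⟩
    rw [hl.localIsotypyFin P v c' hc']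
    exact hfin v
  refine ⟨?_, ?_, ⟨𝔠.sgnInf, ?_⟩⟩
  · intro P M _ _ σK σ𝔤 hM hirr htok δ hδ hne'
    obtain ⟨ξ, hle, -, -⟩ := core P M σK σ𝔤 hM hirr htok δ hδ hne'
    rw [← hpin.1 P]
    exact_mod_cast hle
  · intro P M _ _ σK σ𝔤 hM hirr htok δ hδ hne'
    obtain ⟨ξ, -, -, hfin⟩ := core P M σK σ𝔤 hM hirr htok δ hδ hne'
    exact ⟨ξ, memb P ξ hfin⟩
  · intro P M _ _ σK σ𝔤 hM hirr htok δ hδ hne'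
    obtain ⟨ξ, -, hinf, hfin⟩ := core P M σK σ𝔤 hM hirr htok δ hδ hne'
    refine ⟨ξ, memb P ξ hfin, ?_⟩
    rw [hl.tokenInf P M σK σ𝔤 hM hirr htok] at hinf
    exact hl.archPacketCoh ξ M σK σ𝔤 hM hirr hinf δ hδ hne'

/-! ## §5 THE COMPOSITION over the stubs at a NAMED KIT FAMILY, in the letters' frame shape — and the ★ consumers BY NAME -/

/-- **A KIT FAMILY**: one classification kit per LETTERS' FRAME — `(L ι H T hT)`, `H` definite at the other complex places (`hdef`), `[L⁺:ℚ] ≥ 2` (`h2`), an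
automorphic `μ`, and Rogawski's auxiliary `μω` UNITARY with `μω|_{𝕀_{L⁺}} = ω_{L/L⁺}` (`hμω`, §4.8 p. 51) — exactly the binders of ★ `cohDiscrete_memXiFamily`
(review p819638: without `hdef∕h2∕hμω` the family predicates would ask the laws at frames where `Routing` is false for the genuine model).  The NAMED kit `𝔠₀`
of ED. 4 is such a family whose pinned fields are ★ defs and whose posited fields are explicit parameters (REF1 R-5 (c): never `∃ kit`).
[cite: Rogawski1990, §4.8 p. 51; §14.6 Thm. 14.6.4] -/
def KitFamily : Type 1 :=
  ∀ (L : Type) [Field L] [NumberField L] [IsCMField L] (ι : L →+* ℂ) (H : Matrix (Fin 3) (Fin 3) L) (T : GL (Fin 3) ℂ)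
    (hT : (T : Matrix (Fin 3) (Fin 3) ℂ)ᴴ * H.map ι * (T : Matrix (Fin 3) (Fin 3) ℂ) = Literature.Geometry.ComplexHyperbolic.BallModel.J),
    (∀ τ' : L →+* ℂ, InfinitePlace.mk τ' ≠ InfinitePlace.mk ι → (H.map τ').PosDef) →
    2 ≤ Module.finrank ℚ ↥(maximalRealSubfield L) →
    ∀ (μ : Measure (adelicGroupData (↥(maximalRealSubfield L)) L (IsCMField.complexConj L) 3 H).automorphicQuotient)
    [(adelicGroupData (↥(maximalRealSubfield L)) L (IsCMField.complexConj L) 3 H).IsAutomorphicMeasure μ]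
    (μω : HeckeCharacter L) (hμu : μω.IsUnitary),
    (∀ x : Literature.NumberTheory.GaloisRepresentations.ideleGroup ↥(maximalRealSubfield L),
      μω (AdeleRing.ideleBaseChange (↥(maximalRealSubfield L)) L x) = quadraticHeckeCharCM L x) → ClassificationKit L H ι T hT μ

/-- The family is PINNED at every letters' frame. [cite: Rogawski1990, §14.6 Thm. 14.6.4] -/
def KitFamily.IsPinned (𝔎 : KitFamily) : Prop :=
  ∀ (L : Type) [Field L] [NumberField L] [IsCMField L] (ι : L →+* ℂ) (H : Matrix (Fin 3) (Fin 3) L) (T : GL (Fin 3) ℂ)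
    (hT : (T : Matrix (Fin 3) (Fin 3) ℂ)ᴴ * H.map ι * (T : Matrix (Fin 3) (Fin 3) ℂ) = Literature.Geometry.ComplexHyperbolic.BallModel.J),
    ∀ (hdef : ∀ τ' : L →+* ℂ, InfinitePlace.mk τ' ≠ InfinitePlace.mk ι → (H.map τ').PosDef)
    (h2 : 2 ≤ Module.finrank ℚ ↥(maximalRealSubfield L))
    (μ : Measure (adelicGroupData (↥(maximalRealSubfield L)) L (IsCMField.complexConj L) 3 H).automorphicQuotient)
    [(adelicGroupData (↥(maximalRealSubfield L)) L (IsCMField.complexConj L) 3 H).IsAutomorphicMeasure μ]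
    (μω : HeckeCharacter L) (hμu : μω.IsUnitary),
    ∀ (hμω : ∀ x : Literature.NumberTheory.GaloisRepresentations.ideleGroup ↥(maximalRealSubfield L),
      μω (AdeleRing.ideleBaseChange (↥(maximalRealSubfield L)) L x) = quadraticHeckeCharCM L x), (𝔎 L ι H T hT hdef h2 μ μω hμu hμω).IsPinned

/-- The family satisfies the LAWS at every letters' frame (at ED. 4: one open instance per law at `𝔠₀`). [cite: Rogawski1990, §14.6 Thm. 14.6.4] -/
def KitFamily.Laws (𝔎 : KitFamily) : Prop :=
  ∀ (L : Type) [Field L] [NumberField L] [IsCMField L] (ι : L →+* ℂ) (H : Matrix (Fin 3) (Fin 3) L) (T : GL (Fin 3) ℂ)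
    (hT : (T : Matrix (Fin 3) (Fin 3) ℂ)ᴴ * H.map ι * (T : Matrix (Fin 3) (Fin 3) ℂ) = Literature.Geometry.ComplexHyperbolic.BallModel.J),
    ∀ (hdef : ∀ τ' : L →+* ℂ, InfinitePlace.mk τ' ≠ InfinitePlace.mk ι → (H.map τ').PosDef)
    (h2 : 2 ≤ Module.finrank ℚ ↥(maximalRealSubfield L))
    (μ : Measure (adelicGroupData (↥(maximalRealSubfield L)) L (IsCMField.complexConj L) 3 H).automorphicQuotient)
    [(adelicGroupData (↥(maximalRealSubfield L)) L (IsCMField.complexConj L) 3 H).IsAutomorphicMeasure μ]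
    (μω : HeckeCharacter L) (hμu : μω.IsUnitary),
    ∀ (hμω : ∀ x : Literature.NumberTheory.GaloisRepresentations.ideleGroup ↥(maximalRealSubfield L),
      μω (AdeleRing.ideleBaseChange (↥(maximalRealSubfield L)) L x) = quadraticHeckeCharCM L x), (𝔎 L ι H T hT hdef h2 μ μω hμu hμω).Laws μω hμu

/-- **`shapeGuarded_of_T5`**: the stubs + a NAMED pinned kit family with the laws ⇒ `∀ frame, (C1♮) ∧ (C2) ∧ (C3₀)` — the shape p04 (g6)'s B0
`F0P3GuardedLettersOfClassificationShape.letters_guarded_of_shape` consumes (`StubE1coh ∧ cohDiscrete_memXiFamily ∧ StubBetaOppAdm` with U♭).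
[cite: Rogawski1990, §14.6 Thm. 14.6.4] -/
theorem shapeGuarded_of_T5 (𝔎 : KitFamily) (hpin : 𝔎.IsPinned) (hlaws : 𝔎.Laws) :
    ∀ (L : Type) [Field L] [NumberField L] [IsCMField L] (ι : L →+* ℂ) (H : Matrix (Fin 3) (Fin 3) L) (T : GL (Fin 3) ℂ)
      (hT : (T : Matrix (Fin 3) (Fin 3) ℂ)ᴴ * H.map ι * (T : Matrix (Fin 3) (Fin 3) ℂ) = Literature.Geometry.ComplexHyperbolic.BallModel.J),
      (∀ τ' : L →+* ℂ, InfinitePlace.mk τ' ≠ InfinitePlace.mk ι → (H.map τ').PosDef) →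
      2 ≤ Module.finrank ℚ ↥(maximalRealSubfield L) →
      ∀ (μ : Measure (adelicGroupData (↥(maximalRealSubfield L)) L (IsCMField.complexConj L) 3 H).automorphicQuotient)
        [(adelicGroupData (↥(maximalRealSubfield L)) L (IsCMField.complexConj L) 3 H).IsAutomorphicMeasure μ]
        (μω : HeckeCharacter L) (hμu : μω.IsUnitary),
        (∀ x : Literature.NumberTheory.GaloisRepresentations.ideleGroup ↥(maximalRealSubfield L),
          μω (AdeleRing.ideleBaseChange (↥(maximalRealSubfield L)) L x) = quadraticHeckeCharCM L x) →
      (∀ (P : DiscreteAutomorphicRep (adelicGroupData (↥(maximalRealSubfield L)) L (IsCMField.complexConj L) 3 H) μ)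
        (M : Type) [AddCommGroup M] [Module ℂ M] (σK : Representation ℂ (uFormGroup (Fin 2) (Fin 1)).maximalCompact M)
        (σ𝔤 : (uFormGroup (Fin 2) (Fin 1)).lie →ₗ⁅ℝ⁆ Module.End ℂ M) (hM : IsGKModule (uFormGroup (Fin 2) (Fin 1)) σK σ𝔤),
        IsIrreducibleGK σK σ𝔤 →
        (∃ T₁ : P.archModuleCM ι T hT →ₗ[ℂ] M,
          (∀ (k : (uFormGroup (Fin 2) (Fin 1)).maximalCompact) (w : P.archModuleCM ι T hT),
              T₁ (P.archRepKCM ι T hT k w) = σK k (T₁ w)) ∧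
            (∀ (X : (uFormGroup (Fin 2) (Fin 1)).lie) (w : P.archModuleCM ι T hT),
              T₁ (P.archRepLieCM ι T hT X w) = σ𝔤 X (T₁ w)) ∧ T₁ ≠ 0) →
        ∀ δ : ℤ, (δ = 1 ∨ δ = -1) → upqTypeClasses σK σ𝔤 hM.ad_compat 1 δ ≠ ⊥ →
          ((adelicGroupData (↥(maximalRealSubfield L)) L (IsCMField.complexConj L) 3 H).rightRegular μ).multiplicity
            P.space.toContRep ≤ 1) ∧
      (∀ (P : DiscreteAutomorphicRep (adelicGroupData (↥(maximalRealSubfield L)) L (IsCMField.complexConj L) 3 H) μ)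
        (M : Type) [AddCommGroup M] [Module ℂ M] (σK : Representation ℂ (uFormGroup (Fin 2) (Fin 1)).maximalCompact M)
        (σ𝔤 : (uFormGroup (Fin 2) (Fin 1)).lie →ₗ⁅ℝ⁆ Module.End ℂ M) (hM : IsGKModule (uFormGroup (Fin 2) (Fin 1)) σK σ𝔤),
        IsIrreducibleGK σK σ𝔤 →
        (∃ T₁ : P.archModuleCM ι T hT →ₗ[ℂ] M,
          (∀ (k : (uFormGroup (Fin 2) (Fin 1)).maximalCompact) (w : P.archModuleCM ι T hT),
              T₁ (P.archRepKCM ι T hT k w) = σK k (T₁ w)) ∧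
            (∀ (X : (uFormGroup (Fin 2) (Fin 1)).lie) (w : P.archModuleCM ι T hT),
              T₁ (P.archRepLieCM ι T hT X w) = σ𝔤 X (T₁ w)) ∧ T₁ ≠ 0) →
        ∀ δ : ℤ, (δ = 1 ∨ δ = -1) → upqTypeClasses σK σ𝔤 hM.ad_compat 1 δ ≠ ⊥ →
          ∃ ξ : OneDimAutRepH L,
            MemXiFamily P (transpose_map_cmConjRingHom_eq_of_frame L ι H T hT) (isUnit_det_of_frame L ι H T hT) μω hμu ξ) ∧
      (∃ sgn : OneDimAutRepH L → ℤ,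
        ∀ (P : DiscreteAutomorphicRep (adelicGroupData (↥(maximalRealSubfield L)) L (IsCMField.complexConj L) 3 H) μ),
          ∀ (M : Type) [AddCommGroup M] [Module ℂ M] (σK : Representation ℂ (uFormGroup (Fin 2) (Fin 1)).maximalCompact M)
            (σ𝔤 : (uFormGroup (Fin 2) (Fin 1)).lie →ₗ⁅ℝ⁆ Module.End ℂ M) (hM : IsGKModule (uFormGroup (Fin 2) (Fin 1)) σK σ𝔤),
            IsIrreducibleGK σK σ𝔤 →
            (∃ T₁ : P.archModuleCM ι T hT →ₗ[ℂ] M,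
              (∀ (k : (uFormGroup (Fin 2) (Fin 1)).maximalCompact) (w : P.archModuleCM ι T hT),
                  T₁ (P.archRepKCM ι T hT k w) = σK k (T₁ w)) ∧
                (∀ (X : (uFormGroup (Fin 2) (Fin 1)).lie) (w : P.archModuleCM ι T hT),
                  T₁ (P.archRepLieCM ι T hT X w) = σ𝔤 X (T₁ w)) ∧ T₁ ≠ 0) →
            ∀ δ : ℤ, (δ = 1 ∨ δ = -1) → upqTypeClasses σK σ𝔤 hM.ad_compat 1 δ ≠ ⊥ →
            ∃ ξ : OneDimAutRepH L, MemXiFamily P (transpose_map_cmConjRingHom_eq_of_frame L ι H T hT) (isUnit_det_of_frame L ι H T hT) μω hμu ξ ∧ δ = sgn ξ) := by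
  intro L _ _ _ ι H T hT hdef h2 μ _ μω hμu hμω
  have hp := hpin L ι H T hT hdef h2 μ μω hμu hμω
  have hl := hlaws L ι H T hT hdef h2 μ μω hμu hμω
  exact shape_of_T5 H ι T hT μ μω hμu (𝔎 L ι H T hT hdef h2 μ μω hμu hμω) hp hl
    (perClassIdentity_of_laws _ hl.traceIdentity hl.spectralSideGp hl.factorisation hl.matchingS
      (separation_of_laws _ (hatInjective_of_pins _ hp hl.evpConvention) hl.hatBounded hl.unrStarAlgebra) hl.unrStarAlgebra)
    (coefficientFormula_of_laws _
      (perClassIdentity_of_laws _ hl.traceIdentity hl.spectralSideGp hl.factorisation hl.matchingS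
        (separation_of_laws _ (hatInjective_of_pins _ hp hl.evpConvention) hl.hatBounded hl.unrStarAlgebra) hl.unrStarAlgebra)
      hl.transferS hl.linIndepS hl.unitaryCoord hl.unitaryPacket (classDet_of_pins _ hp hl.flathDet) hl.aPacketSpectral hl.localExpansion)

/-- **CONSUMER CHECK (C2)**: S2♭ `Rogawski1990.cohDiscrete_memXiFamily` BY NAME from the head's third conjunct via ★ p814530 `cohDiscrete_memXiFamily_of_C30`
(and equally from the second conjunct via ★ p814159 `cohDiscrete_memXiFamily_of_shape`). -/
example (𝔎 : KitFamily) (hpin : 𝔎.IsPinned) (hlaws : 𝔎.Laws) : cohDiscrete_memXiFamily :=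
  F0P3LettersOfClassificationShapeRigid.cohDiscrete_memXiFamily_of_C30
    fun L _ _ _ ι H T hT hdef h2 μ _ μω hμu hμω => (shapeGuarded_of_T5 𝔎 hpin hlaws L ι H T hT hdef h2 μ μω hμu hμω).2.2

example (𝔎 : KitFamily) (hpin : 𝔎.IsPinned) (hlaws : 𝔎.Laws) : cohDiscrete_memXiFamily :=
  F0P3LettersOfClassificationShape.cohDiscrete_memXiFamily_of_shape
    fun L _ _ _ ι H T hT hdef h2 μ _ μω hμu hμω => (shapeGuarded_of_T5 𝔎 hpin hlaws L ι H T hT hdef h2 μ μω hμu hμω).2.1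

end Summit.HodgeConjecture.HodgeConjecture.Cruxes.H413.F0P3InnerFormClassification
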